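import Literature.IUT.LogVolume.PadicBoxVolume
import Literature.IUT.LogVolume.LatticeAutomorphisms
import HarnessLib

/-!
# Lattice automorphisms of a `p`-adic lattice act transitively on primitive vectors; the additive
# span of one orbit (Weil, *Basic Number Theory*, Ch. II §2, Th. 1–2; Cassels, *Geometry of Numbers*,
# Ch. I, Th. I Cor. 3)

Classical `ℤ_p`-lattice algebra for the abc-iut cell's REAL tensor-packet model: `HOME/skel/FORK-REAL-MODEL.md`
§4 "MISSING FOR A TWO-SIDED KERNEL STATEMENT: the hull LOWER bound `hull(⋃_{g∈G₂} g·(ι(t)·O)) ⊇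
p^m·hull(𝓘-lattice)` (GL(Λ) acts transitively on primitive vectors of the ℤ_p-lattice Λ = log_p(R_I^×), so the
orbit of a sublattice not inside p^{m+1}Λ covers the primitive vectors of p^mΛ, whose span is p^mΛ) — … GRANTED
THAT (standard p-adic lattice algebra, not in the tree)". This file IS that algebra, for the lattice `Λ = L_b`
of a basis `b` of a `ℚ_p`-vector space `W` (tree `PadicModule.basisLattice`; by Weil Ch. II §2 Th. 1 every
lattice is one, and a box lattice `⊕ c_i ℤ_p b_i` — e.g. `log_p(R_I^×)`, `packetOf_eq_boxLattice` — is the lattice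
of the rescaled basis, `boxLattice_eq_basisLattice_unitsSMul`) and the group `Aut_{ℚ_p}(W : Λ)` (tree
`latticeAut`, the shape of the cell's (Ind2) group `indTwo`):

* `exists_latticeAut_map_basis_eq`: a PRIMITIVE vector `x ∈ Λ` (one `b`-coordinate of norm `1`, i.e.
  `x ∉ p·Λ`, `primitive_iff_not_mem_p_smul`) is the image of a basis vector under a lattice automorphism
  — the explicit automorphism `w ↦ w + x_{i}(w)·(x − b_i)` (its inverse divides by the unit coordinate);
  this is Weil's Th. 1 with the flag `W_n = ℚ_p·x` ("a primitive point may be taken as part of a basis",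
  Cassels Ch. I Th. I Cor. 3) in automorphism form;
* `equiv_mem_latticeAut`: coordinate permutations are lattice automorphisms; hence
  `exists_latticeAut_map_eq`: `Aut_{ℚ_p}(W : Λ)` acts TRANSITIVELY on primitive vectors;
* `basisLattice_le_closure_primitive`: every lattice vector is a `ℤ`-combination of primitive vectors
  (`c·b_i = (c+1)·b_i − b_i` with `‖c+1‖ = 1` when `‖c‖ < 1`), so the additive closure of ONE orbit of a
  primitive vector is `Λ` (`closure_orbit_eq_basisLattice`);
* the SCALED / REGION forms the hull bound wants: every `x ≠ 0` is `c·x₀` with `x₀` primitive and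
  `‖c‖ = max_i ‖x_i‖` (`exists_eq_smul_primitive`); if a set `M` contains `c·x₀` then
  `c·Λ ⊆ closure(⋃_{φ ∈ Aut} φ(M))` (`smul_basisLattice_subset_closure_iUnion_image`), with the matching
  upper bound when `M ⊆ c·Λ` (`iUnion_image_subset_smul_basisLattice`): the orbit of a region of
  "content" `c` additively generates EXACTLY `c·Λ`.

[cite: WeilBNT1967, Ch. II §2, Th. 1] [cite: Cassels1997, Ch. I §2, Th. I Cor. 3]
No side is taken on [IUTchIII] Cor. 3.12; nothing here is about volumes or hulls of the tensor packet (that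
assembly — `packetHull ⊇` the additive closure, `indTwo = latticeAut` of a box lattice — is the consumer's).
PROOF-ONLY file: no new definitions, no named `Prop` facts.
-/

noncomputable section

open scoped Pointwise

namespace Literature.IUT.LogVolume

namespace PadicModule

variable (p : ℕ) [Fact p.Prime]
variable {W : Type*} [AddCommGroup W] [Module ℚ_[p] W]
variable {ι : Type*} [Fintype ι]

/-! ### Box lattices are basis lattices -/

/-- A box lattice `⊕_i c_i ℤ_p b_i` is the lattice of the rescaled basis `(c_i b_i)_i` (so everything below
applies to box lattices, e.g. `log_p(R_I^×)`). [cite: WeilBNT1967, Ch. II §2, Th. 1] -/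
theorem boxLattice_eq_basisLattice_unitsSMul (b : Module.Basis ι ℚ_[p] W) (c : ι → ℚ_[p]ˣ) :
    boxLattice p b c = basisLattice p (b.unitsSMul c) := by
  ext w
  rw [mem_boxLattice, mem_basisLattice]
  refine forall_congr' fun i => ?_
  rw [Module.Basis.repr_unitsSMul, Units.smul_def, smul_eq_mul, norm_mul, Units.val_inv_eq_inv_val,
    norm_inv, inv_mul_le_iff₀ (norm_pos_iff.mpr (c i).ne_zero), mul_one]

/-- Membership in `Aut_{ℚ_p}(W : L_b)` unfolded: `φ ∈ Aut ↔ ∀ w, (φ w ∈ L_b ↔ w ∈ L_b)`.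
[cite: WeilBNT1967, Ch. II §2, Th. 1] -/
theorem mem_latticeAut_basisLattice_iff (b : Module.Basis ι ℚ_[p] W) (φ : W ≃ₗ[ℚ_[p]] W) :
    φ ∈ latticeAut ℚ_[p] (basisLattice p b).toIntSubmodule ↔
      ∀ w, φ w ∈ basisLattice p b ↔ w ∈ basisLattice p b :=
  Iff.rfl

/-- A lattice automorphism maps `c·L_b` onto `c·L_b` for every scalar `c`.
[cite: WeilBNT1967, Ch. II §2, Th. 1] -/
theorem image_smul_basisLattice_of_mem (b : Module.Basis ι ℚ_[p] W) {φ : W ≃ₗ[ℚ_[p]] W}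
    (hφ : φ ∈ latticeAut ℚ_[p] (basisLattice p b).toIntSubmodule) (c : ℚ_[p]) :
    φ '' (c • (basisLattice p b : Set W)) = c • (basisLattice p b : Set W) := by
  have hφ' := (mem_latticeAut_basisLattice_iff p b φ).mp hφ
  ext y
  constructor
  · rintro ⟨_, ⟨w, hw, rfl⟩, rfl⟩
    exact ⟨φ w, (hφ' w).mpr hw, (LinearEquiv.map_smul φ c w).symm⟩
  · rintro ⟨w, hw, rfl⟩
    have hw' : φ.symm w ∈ basisLattice p b := by
      have := hφ' (φ.symm w)
      rw [LinearEquiv.apply_symm_apply] at this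
      exact this.mp hw
    exact ⟨c • φ.symm w, Set.smul_mem_smul_set hw', by
      rw [LinearEquiv.map_smul, LinearEquiv.apply_symm_apply]⟩

/-! ### Coordinate permutations are lattice automorphisms -/

omit [Fintype ι] in
/-- Coordinates of `b.equiv b e w`: `(b.equiv b e w)_j = w_{e⁻¹ j}`. [cite: WeilBNT1967, Ch. II §2, Th. 1] -/
theorem repr_equiv_apply (b : Module.Basis ι ℚ_[p] W) (e : ι ≃ ι) (w : W) (j : ι) :
    b.repr (b.equiv b e w) j = b.repr w (e.symm j) := by
  classical
  have h : (b.coord j).comp (b.equiv b e).toLinearMap = b.coord (e.symm j) := by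
    refine b.ext fun k => ?_
    simp only [LinearMap.coe_comp, LinearEquiv.coe_coe, Function.comp_apply, Module.Basis.equiv_apply,
      Module.Basis.coord_apply, Module.Basis.repr_self, Finsupp.single_apply,
      Equiv.apply_eq_iff_eq_symm_apply]
  exact LinearMap.congr_fun h w

/-- **Coordinate permutations preserve the lattice**: `b_i ↦ b_{e i}` lies in `Aut_{ℚ_p}(W : L_b)` (the shape
of (Ind1) at one summand). [cite: WeilBNT1967, Ch. II §2, Th. 1] -/
theorem equiv_mem_latticeAut (b : Module.Basis ι ℚ_[p] W) (e : ι ≃ ι) :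
    b.equiv b e ∈ latticeAut ℚ_[p] (basisLattice p b).toIntSubmodule := by
  rw [mem_latticeAut_basisLattice_iff]
  intro w
  rw [mem_basisLattice, mem_basisLattice]
  constructor
  · intro h i
    have := h (e i)
    rwa [repr_equiv_apply, Equiv.symm_apply_apply] at this
  · intro h j
    rw [repr_equiv_apply]
    exact h _

/-! ### A primitive vector is the image of a basis vector under a lattice automorphism -/

/-- **Primitive vectors extend to bases, automorphism form** (Weil Ch. II §2 Th. 1 with the flag
`W_n = ℚ_p·x`; Cassels Ch. I Th. I Cor. 3): if `x ∈ L_b` has `i`-th coordinate a UNIT, the map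
`w ↦ w + w_i·(x − b_i)` is a `ℚ_p`-linear automorphism of `W` (inverse `w ↦ w − (w_i/x_i)·(x − b_i)`) mapping
`L_b` onto itself and `b_i` to `x`. [cite: WeilBNT1967, Ch. II §2, Th. 1] [cite: Cassels1997, Ch. I §2, Th. I Cor. 3] -/
theorem exists_latticeAut_map_basis_eq (b : Module.Basis ι ℚ_[p] W) {x : W} (hx : x ∈ basisLattice p b)
    {i : ι} (hi : ‖b.repr x i‖ = 1) :
    ∃ φ : W ≃ₗ[ℚ_[p]] W, φ ∈ latticeAut ℚ_[p] (basisLattice p b).toIntSubmodule ∧ φ (b i) = x := by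
  classical
  set c : ℚ_[p] := b.repr x i with hc
  have hc0 : c ≠ 0 := norm_ne_zero_iff.mp (by rw [hi]; exact one_ne_zero)
  let f : W →ₗ[ℚ_[p]] ℚ_[p] := b.coord i
  have hf : ∀ w, f w = b.repr w i := fun w => rfl
  let v : W := x - b i
  have hfv : f v = c - 1 := by
    rw [hf, map_sub, Finsupp.sub_apply, Module.Basis.repr_self, Finsupp.single_eq_same]
  let T : W →ₗ[ℚ_[p]] W := LinearMap.id + f.smulRight v
  let S : W →ₗ[ℚ_[p]] W := LinearMap.id - (c⁻¹ • f).smulRight v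
  have hT : ∀ w, T w = w + f w • v := fun w => rfl
  have hS : ∀ w, S w = w - (c⁻¹ * f w) • v := fun w => rfl
  have hTS : T.comp S = LinearMap.id := by
    ext w
    rw [LinearMap.comp_apply, LinearMap.id_apply, hT, hS, map_sub, map_smul, hfv, smul_eq_mul]
    have key : -(c⁻¹ * f w) + (f w - c⁻¹ * f w * (c - 1)) = 0 := by
      field_simp
      ring
    rw [sub_eq_add_neg, ← neg_smul, add_assoc, ← add_smul, key, zero_smul, add_zero]
  have hST : S.comp T = LinearMap.id := by
    ext w
    rw [LinearMap.comp_apply, LinearMap.id_apply, hS, hT, map_add, map_smul, hfv, smul_eq_mul]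
    have key : f w + -(c⁻¹ * (f w + f w * (c - 1))) = 0 := by
      field_simp
      ring
    rw [sub_eq_add_neg, ← neg_smul, add_assoc, ← add_smul, key, zero_smul, add_zero]
  refine ⟨LinearEquiv.ofLinear T S hTS hST, ?_, ?_⟩
  · refine mem_latticeAut_of_mapsTo _ (fun w hw => ?_) (fun w hw => ?_)
    · change T w ∈ basisLattice p b
      change w ∈ basisLattice p b at hw
      rw [hT]
      refine add_mem hw (smul_mem_basisLattice p b ?_ (sub_mem hx (basis_mem_basisLattice p b i)))
      rw [hf]
      exact (mem_basisLattice p b).mp hw i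
    · change S w ∈ basisLattice p b
      change w ∈ basisLattice p b at hw
      rw [hS]
      refine sub_mem hw (smul_mem_basisLattice p b ?_ (sub_mem hx (basis_mem_basisLattice p b i)))
      rw [norm_mul, norm_inv, hi, inv_one, one_mul, hf]
      exact (mem_basisLattice p b).mp hw i
  · change T (b i) = x
    rw [hT, hf, Module.Basis.repr_self, Finsupp.single_eq_same, one_smul]
    exact add_sub_cancel (b i) x

/-- **`Aut_{ℚ_p}(W : Λ)` acts transitively on primitive vectors**: for `x, y ∈ L_b` each with SOME
coordinate a unit, there is a lattice automorphism with `φ x = y` (`φ = ψ_y ∘ (b_i ↦ b_j) ∘ ψ_x⁻¹`).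
[cite: WeilBNT1967, Ch. II §2, Th. 1] [cite: Cassels1997, Ch. I §2, Th. I Cor. 3] -/
theorem exists_latticeAut_map_eq (b : Module.Basis ι ℚ_[p] W) {x y : W} (hx : x ∈ basisLattice p b)
    (hy : y ∈ basisLattice p b) {i j : ι} (hi : ‖b.repr x i‖ = 1) (hj : ‖b.repr y j‖ = 1) :
    ∃ φ : W ≃ₗ[ℚ_[p]] W, φ ∈ latticeAut ℚ_[p] (basisLattice p b).toIntSubmodule ∧ φ x = y := by
  classical
  obtain ⟨φ, hφ, hφx⟩ := exists_latticeAut_map_basis_eq p b hx hi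
  obtain ⟨ψ, hψ, hψy⟩ := exists_latticeAut_map_basis_eq p b hy hj
  refine ⟨ψ * b.equiv b (Equiv.swap i j) * φ⁻¹,
    mul_mem (mul_mem hψ (equiv_mem_latticeAut p b _)) (inv_mem hφ), ?_⟩
  change ψ (b.equiv b (Equiv.swap i j) (φ.symm x)) = y
  rw [show φ.symm x = b i from (LinearEquiv.symm_apply_eq φ).mpr hφx.symm, Module.Basis.equiv_apply,
    Equiv.swap_apply_left, hψy]

/-! ### Every lattice vector is a `ℤ`-combination of primitive vectors -/

/-- A vector `d • b_i` with `‖d‖ = 1` is primitive. [cite: WeilBNT1967, Ch. II §2, Th. 1] -/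
theorem unit_smul_basis_primitive (b : Module.Basis ι ℚ_[p] W) {d : ℚ_[p]} (hd : ‖d‖ = 1) (i : ι) :
    d • b i ∈ basisLattice p b ∧ ‖b.repr (d • b i) i‖ = 1 := by
  classical
  refine ⟨smul_mem_basisLattice p b hd.le (basis_mem_basisLattice p b i), ?_⟩
  rw [map_smul, Finsupp.smul_apply, Module.Basis.repr_self, Finsupp.single_eq_same, smul_eq_mul, mul_one, hd]

/-- **The primitive vectors generate the lattice additively**: `L_b ⊆ closure {x ∈ L_b | some x_i is a
unit}` — write `w = Σ w_i b_i`; a term with `‖w_i‖ = 1` is primitive, and one with `‖w_i‖ < 1` is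
`(w_i + 1) b_i − b_i` with `‖w_i + 1‖ = 1` (ultrametric). [cite: WeilBNT1967, Ch. II §2, Th. 1] -/
theorem basisLattice_le_closure_primitive (b : Module.Basis ι ℚ_[p] W) :
    basisLattice p b ≤
      AddSubgroup.closure {x | x ∈ basisLattice p b ∧ ∃ i, ‖b.repr x i‖ = 1} := by
  classical
  intro w hw
  rw [← b.sum_repr w]
  refine AddSubgroup.sum_mem _ fun i _ => ?_
  have ha : ‖b.repr w i‖ ≤ 1 := (mem_basisLattice p b).mp hw i
  have hprim : ∀ d : ℚ_[p], ‖d‖ = 1 →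
      d • b i ∈ AddSubgroup.closure {x | x ∈ basisLattice p b ∧ ∃ i, ‖b.repr x i‖ = 1} :=
    fun d hd => AddSubgroup.subset_closure
      ⟨(unit_smul_basis_primitive p b hd i).1, i, (unit_smul_basis_primitive p b hd i).2⟩
  rcases ha.lt_or_eq with hlt | heq
  · have h1 : ‖b.repr w i + 1‖ = 1 := by
      rw [Padic.add_eq_max_of_ne (by rw [norm_one]; exact hlt.ne), norm_one, max_eq_right hlt.le]
    have : b.repr w i • b i = (b.repr w i + 1) • b i - (1 : ℚ_[p]) • b i := by
      rw [add_smul, add_sub_cancel_right]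
    rw [this]
    exact sub_mem (hprim _ h1) (hprim _ norm_one)
  · exact hprim _ heq

/-! ### The additive span of one orbit -/

/-- The orbit of a lattice vector stays in the lattice. [cite: WeilBNT1967, Ch. II §2, Th. 1] -/
theorem orbit_subset_basisLattice (b : Module.Basis ι ℚ_[p] W) {x : W} (hx : x ∈ basisLattice p b) :
    {y | ∃ φ : W ≃ₗ[ℚ_[p]] W, φ ∈ latticeAut ℚ_[p] (basisLattice p b).toIntSubmodule ∧ φ x = y} ⊆
      (basisLattice p b : Set W) := by
  rintro _ ⟨φ, hφ, rfl⟩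
  exact ((mem_latticeAut_basisLattice_iff p b φ).mp hφ x).mpr hx

/-- **The orbit of a primitive vector additively generates the whole lattice**:
`L_b ⊆ closure (Aut·x)` for `x ∈ L_b` primitive (transitivity + `basisLattice_le_closure_primitive`).
[cite: WeilBNT1967, Ch. II §2, Th. 1] [cite: Cassels1997, Ch. I §2, Th. I Cor. 3] -/
theorem basisLattice_le_closure_orbit (b : Module.Basis ι ℚ_[p] W) {x : W} (hx : x ∈ basisLattice p b)
    {i : ι} (hi : ‖b.repr x i‖ = 1) :
    basisLattice p b ≤ AddSubgroup.closure
      {y | ∃ φ : W ≃ₗ[ℚ_[p]] W, φ ∈ latticeAut ℚ_[p] (basisLattice p b).toIntSubmodule ∧ φ x = y} := by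
  refine (basisLattice_le_closure_primitive p b).trans (AddSubgroup.closure_mono ?_)
  rintro y ⟨hy, j, hj⟩
  exact exists_latticeAut_map_eq p b hx hy hi hj

/-- **`closure (Aut·x) = L_b`** for a primitive `x`. [cite: WeilBNT1967, Ch. II §2, Th. 1] -/
theorem closure_orbit_eq_basisLattice (b : Module.Basis ι ℚ_[p] W) {x : W} (hx : x ∈ basisLattice p b)
    {i : ι} (hi : ‖b.repr x i‖ = 1) :
    AddSubgroup.closure
        {y | ∃ φ : W ≃ₗ[ℚ_[p]] W, φ ∈ latticeAut ℚ_[p] (basisLattice p b).toIntSubmodule ∧ φ x = y} =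
      basisLattice p b :=
  le_antisymm ((AddSubgroup.closure_le _).mpr (orbit_subset_basisLattice p b hx))
    (basisLattice_le_closure_orbit p b hx hi)

/-! ### Scaled form: vectors of content `c` -/

/-- **Every nonzero vector is `c • x₀` with `x₀` primitive** and `‖c‖ = max_i ‖x_i‖` (take `c := x_{i₀}` a
coordinate of largest norm; Weil Ch. II §2 Th. 2 / Cor. 1 for the rank-one module `ℤ_p x`).
[cite: WeilBNT1967, Ch. II §2, Th. 2] -/
theorem exists_eq_smul_primitive (b : Module.Basis ι ℚ_[p] W) {x : W} (hx : x ≠ 0) :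
    ∃ (c : ℚ_[p]) (x₀ : W) (i : ι), c ≠ 0 ∧ x₀ ∈ basisLattice p b ∧ ‖b.repr x₀ i‖ = 1 ∧ x = c • x₀ ∧
      ∀ j, ‖b.repr x j‖ ≤ ‖c‖ := by
  classical
  have hne : (Finset.univ : Finset ι).Nonempty := by
    by_contra h
    rw [Finset.not_nonempty_iff_eq_empty, Finset.univ_eq_empty_iff] at h
    exact hx (b.repr.injective (Subsingleton.elim _ _))
  obtain ⟨i, -, hi⟩ := Finset.exists_max_image Finset.univ (fun j => ‖b.repr x j‖) hne
  set c : ℚ_[p] := b.repr x i with hc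
  have hc0 : c ≠ 0 := by
    intro h0
    apply hx
    refine b.repr.injective (Finsupp.ext fun j => ?_)
    have := hi j (Finset.mem_univ j)
    rw [h0, norm_zero] at this
    rw [map_zero, Finsupp.zero_apply]
    exact norm_le_zero_iff.mp this
  refine ⟨c, c⁻¹ • x, i, hc0, ?_, ?_, ?_, fun j => hi j (Finset.mem_univ j)⟩
  · rw [mem_basisLattice]
    intro j
    rw [map_smul, Finsupp.smul_apply, smul_eq_mul, norm_mul, norm_inv,
      inv_mul_le_iff₀ (norm_pos_iff.mpr hc0), mul_one]
    exact hi j (Finset.mem_univ j)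
  · rw [map_smul, Finsupp.smul_apply, smul_eq_mul, norm_mul, norm_inv, ← hc, inv_mul_cancel₀]
    exact norm_ne_zero_iff.mpr hc0
  · rw [smul_smul, mul_inv_cancel₀ hc0, one_smul]

/-- **Primitive ⟺ in `Λ` but not in `p·Λ`** (for `x₀ ∈ L_b`: some coordinate is a unit iff not all
coordinates lie in `pℤ_p`; norms on `ℚ_p` take the values `p^ℤ`). [cite: WeilBNT1967, Ch. II §2, Th. 2] -/
theorem primitive_iff_not_mem_p_smul (b : Module.Basis ι ℚ_[p] W) {x₀ : W} (hx₀ : x₀ ∈ basisLattice p b) :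
    (∃ i, ‖b.repr x₀ i‖ = 1) ↔ x₀ ∉ (p : ℚ_[p]) • (basisLattice p b : Set W) := by
  classical
  have hp1 : ‖(p : ℚ_[p])‖ < 1 := Padic.norm_p_lt_one
  have hp0 : (p : ℚ_[p]) ≠ 0 := Nat.cast_ne_zero.mpr (Fact.out : p.Prime).ne_zero
  constructor
  · rintro ⟨i, hi⟩ ⟨y, hy, rfl⟩
    have hyi : ‖b.repr y i‖ ≤ 1 := (mem_basisLattice p b).mp hy i
    rw [LinearEquiv.map_smul, Finsupp.smul_apply, smul_eq_mul, norm_mul] at hi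
    have : ‖(p : ℚ_[p])‖ * ‖b.repr y i‖ < 1 := by
      calc ‖(p : ℚ_[p])‖ * ‖b.repr y i‖ ≤ ‖(p : ℚ_[p])‖ * 1 :=
            mul_le_mul_of_nonneg_left hyi (norm_nonneg _)
        _ < 1 := by rw [mul_one]; exact hp1
    exact this.ne hi
  · intro h
    by_contra hall
    apply h
    -- every coordinate has norm `< 1`, hence `≤ p⁻¹`: `x₀ = p • (p⁻¹ • x₀)` with `p⁻¹ • x₀ ∈ L_b`
    rw [Set.mem_smul_set]
    refine ⟨(p : ℚ_[p])⁻¹ • x₀, ?_, by rw [smul_smul, mul_inv_cancel₀ hp0, one_smul]⟩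
    rw [SetLike.mem_coe, mem_basisLattice]
    intro j
    have hlt : ‖b.repr x₀ j‖ < 1 :=
      lt_of_le_of_ne ((mem_basisLattice p b).mp hx₀ j) fun hj => hall ⟨j, hj⟩
    have hle : ‖b.repr x₀ j‖ ≤ (p : ℝ) ^ (-1 : ℤ) := by
      have := (Padic.norm_lt_pow_iff_norm_le_pow_sub_one (b.repr x₀ j) 0).mp (by rwa [zpow_zero])
      rwa [zero_sub] at this
    rw [map_smul, Finsupp.smul_apply, smul_eq_mul, norm_mul, norm_inv, Padic.norm_p, inv_inv]
    rw [zpow_neg, zpow_one] at hle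
    have hp' : (0 : ℝ) < p := by exact_mod_cast (Fact.out : p.Prime).pos
    calc (p : ℝ) * ‖b.repr x₀ j‖ ≤ (p : ℝ) * (p : ℝ)⁻¹ := mul_le_mul_of_nonneg_left hle hp'.le
      _ = 1 := mul_inv_cancel₀ hp'.ne'

/-- The orbit of `c • x₀` is `c •` the orbit of `x₀`, inside `c • L_b`. [cite: WeilBNT1967, Ch. II §2, Th. 2] -/
theorem orbit_smul_subset (b : Module.Basis ι ℚ_[p] W) {x₀ : W} (hx₀ : x₀ ∈ basisLattice p b) (c : ℚ_[p]) :
    {y | ∃ φ : W ≃ₗ[ℚ_[p]] W, φ ∈ latticeAut ℚ_[p] (basisLattice p b).toIntSubmodule ∧ φ (c • x₀) = y} ⊆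
      c • (basisLattice p b : Set W) := by
  rintro _ ⟨φ, hφ, rfl⟩
  rw [LinearEquiv.map_smul]
  exact Set.smul_mem_smul_set (((mem_latticeAut_basisLattice_iff p b φ).mp hφ x₀).mpr hx₀)

/-- **The orbit of `c • x₀` (`x₀` primitive) additively generates `c • L_b`**: lower bound.
[cite: WeilBNT1967, Ch. II §2, Th. 2] [cite: Cassels1997, Ch. I §2, Th. I Cor. 3] -/
theorem smul_basisLattice_subset_closure_orbit (b : Module.Basis ι ℚ_[p] W) {x₀ : W}
    (hx₀ : x₀ ∈ basisLattice p b) {i : ι} (hi : ‖b.repr x₀ i‖ = 1) (c : ℚ_[p]) :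
    c • (basisLattice p b : Set W) ⊆ AddSubgroup.closure
      {y | ∃ φ : W ≃ₗ[ℚ_[p]] W, φ ∈ latticeAut ℚ_[p] (basisLattice p b).toIntSubmodule ∧ φ (c • x₀) = y} := by
  -- `c • closure(Aut·x₀) ⊆ closure(Aut·(c•x₀))`: push `w ↦ c • w` through the closure, `φ (c • x₀) = c • φ x₀`
  rintro _ ⟨w, hw, rfl⟩
  have h1 := AddSubgroup.mem_map_of_mem (DistribSMul.toAddMonoidHom W c)
    (basisLattice_le_closure_orbit p b hx₀ hi hw)
  rw [AddMonoidHom.map_closure] at h1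
  refine AddSubgroup.closure_mono ?_ h1
  rintro _ ⟨_, ⟨φ, hφ, rfl⟩, rfl⟩
  exact ⟨φ, hφ, LinearEquiv.map_smul φ c x₀⟩

/-- … and the resulting EQUALITY `closure(Aut·(c•x₀)) = c • L_b` at set level.
[cite: WeilBNT1967, Ch. II §2, Th. 2] -/
theorem coe_closure_orbit_smul_eq (b : Module.Basis ι ℚ_[p] W) {x₀ : W} (hx₀ : x₀ ∈ basisLattice p b)
    {i : ι} (hi : ‖b.repr x₀ i‖ = 1) (c : ℚ_[p]) :
    (AddSubgroup.closure {y | ∃ φ : W ≃ₗ[ℚ_[p]] W,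
        φ ∈ latticeAut ℚ_[p] (basisLattice p b).toIntSubmodule ∧ φ (c • x₀) = y} : Set W) =
      c • (basisLattice p b : Set W) := by
  refine Set.Subset.antisymm ?_ (smul_basisLattice_subset_closure_orbit p b hx₀ hi c)
  -- `c • L_b` is the image of an additive subgroup under `w ↦ c • w`, hence an additive subgroup
  have hsub : c • (basisLattice p b : Set W) =
      ((basisLattice p b).map (DistribSMul.toAddMonoidHom W c) : Set W) := by
    rw [AddSubgroup.coe_map]; rfl
  rw [hsub]
  exact (AddSubgroup.closure_le _).mpr (hsub ▸ orbit_smul_subset p b hx₀ c)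

/-! ### Region form (what the hull lower bound consumes) -/

/-- **If a region `M` contains a vector `c • x₀` of content `c` (`x₀` primitive), the `Aut_{ℚ_p}(W : Λ)`-orbit
of `M` additively generates at least `c • Λ`.** (With `Λ = log_p(R_I^×)`, `Aut = ` (Ind2) and `M` the bare
Θ-region, this is the lattice algebra behind "hull(⋃ g·M) ⊇ p^m·hull(𝓘)".)
[cite: WeilBNT1967, Ch. II §2, Th. 2] [cite: Cassels1997, Ch. I §2, Th. I Cor. 3] -/
theorem smul_basisLattice_subset_closure_iUnion_image (b : Module.Basis ι ℚ_[p] W) {M : Set W} {x₀ : W}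
    (hx₀ : x₀ ∈ basisLattice p b) {i : ι} (hi : ‖b.repr x₀ i‖ = 1) {c : ℚ_[p]} (hM : c • x₀ ∈ M) :
    c • (basisLattice p b : Set W) ⊆ AddSubgroup.closure
      (⋃ φ ∈ latticeAut ℚ_[p] (basisLattice p b).toIntSubmodule, (φ : W ≃ₗ[ℚ_[p]] W) '' M) := by
  refine (smul_basisLattice_subset_closure_orbit p b hx₀ hi c).trans (AddSubgroup.closure_mono ?_)
  rintro _ ⟨φ, hφ, rfl⟩
  exact Set.mem_biUnion hφ ⟨c • x₀, hM, rfl⟩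

/-- **Upper bound**: if `M ⊆ c • Λ` then the whole orbit of `M` stays in `c • Λ` (so, with the previous
theorem, the orbit of a region of content EXACTLY `c` additively generates exactly `c • Λ`).
[cite: WeilBNT1967, Ch. II §2, Th. 2] -/
theorem iUnion_image_subset_smul_basisLattice (b : Module.Basis ι ℚ_[p] W) {M : Set W} {c : ℚ_[p]}
    (hM : M ⊆ c • (basisLattice p b : Set W)) :
    (⋃ φ ∈ latticeAut ℚ_[p] (basisLattice p b).toIntSubmodule, (φ : W ≃ₗ[ℚ_[p]] W) '' M) ⊆
      c • (basisLattice p b : Set W) := by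
  refine Set.iUnion₂_subset fun φ hφ => ?_
  rw [← image_smul_basisLattice_of_mem p b hφ c]
  exact Set.image_mono hM

/-- **Two-sided form at set level**: for a region `M ⊆ c • Λ` containing a vector of content `c`,
`closure(⋃_{φ ∈ Aut} φ(M)) = c • Λ`. [cite: WeilBNT1967, Ch. II §2, Th. 2] -/
theorem coe_closure_iUnion_image_eq (b : Module.Basis ι ℚ_[p] W) {M : Set W} {x₀ : W}
    (hx₀ : x₀ ∈ basisLattice p b) {i : ι} (hi : ‖b.repr x₀ i‖ = 1) {c : ℚ_[p]} (hxM : c • x₀ ∈ M)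
    (hM : M ⊆ c • (basisLattice p b : Set W)) :
    (AddSubgroup.closure
        (⋃ φ ∈ latticeAut ℚ_[p] (basisLattice p b).toIntSubmodule, (φ : W ≃ₗ[ℚ_[p]] W) '' M) : Set W) =
      c • (basisLattice p b : Set W) := by
  refine Set.Subset.antisymm ?_ (smul_basisLattice_subset_closure_iUnion_image p b hx₀ hi hxM)
  rw [← coe_closure_orbit_smul_eq p b hx₀ hi c]
  refine (AddSubgroup.closure_le _).mpr ((iUnion_image_subset_smul_basisLattice p b hM).trans ?_)
  rw [coe_closure_orbit_smul_eq p b hx₀ hi c]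

end PadicModule

end Literature.IUT.LogVolume

end
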